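import Summits.ResolutionOfSingularities.ResolutionOfSingularities.Theorems.EquisingularLiftEquisingularLiftNatCarrierDeltaSectionFrame
import HarnessLib

/-!
# [OURS · L1 W4.5(b)] T-CARRIER-Δ section frame — the dimension of the frame (`dim 𝒪_{P,s(s₀)} = n + 1`)

Support file of the crux chain w45b (cell `res-hironaka`, slot W4.5(b)), working crux **EL♮** (stmt-ResolutionOfSingularities-20038),
registered stub `stub_elnat_tcDeltaPointResolution`; supplier assembly HΔTC₃ (res-type-100): the intermediate binder
`ringKrullDim 𝒪_{X',s(s₀)} = 3 + 1` of res-L1-w45b-lead-2 / res-D-pv-029 (2026-08-27T09:31–09:33Z) pins the number of section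
coordinates to `n = 3`, through `exists_sectionFrame_forall_dim` below (the frame of `…CarrierDeltaSectionFrame` rev 4 with
`IsRsopPart`-dimension count, Matsumura 14.2: `dim R/(c) + n = dim R`, `R/(c) ≅ O` of dimension one). OURS; NOT a statement of
any manuscript; AI-written. Filed `--supports stmt-ResolutionOfSingularities-20038 --as helper`.
-/

set_option linter.dupNamespace false -- mandated namespace `Summit.<Summit>.<Problem>` of this single-conjunct summit
set_option linter.overlappingInstances false -- signatures carry `[IsDomain O] [IsDiscreteValuationRing O]`

noncomputable section

open CategoryTheory AlgebraicGeometry TopologicalSpace IsLocalRing Opposite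
open Literature.AlgebraicGeometry.Resolution
open Summit.ResolutionOfSingularities.ResolutionOfSingularities.Cruxes.EquisingularLift.StrataSplit

namespace Summit.ResolutionOfSingularities.ResolutionOfSingularities.Cruxes.EquisingularLiftNat.Sections

variable (O : Type) [CommRing O] [IsDomain O] [IsDiscreteValuationRing O]

/-- **Dimension of the frame (rev 5).** In the situation of `exists_sectionFrame_forall`, for EVERY system of
generators `c : Fin n → 𝒪_{P,s(s₀)}` of `(ker s)_{s(s₀)}` which is part of a regular system of parameters
(e.g. the one produced there) one has `dim 𝒪_{P,s(s₀)} = n + 1`; conversely the frame can be chosen with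
`IsRsopPart c`, hence `n + 1 = dim` — so a hypothesis `dim = 4` pins `n = 3`. [cite: Matsumura1987, Thm. 14.2] -/
theorem exists_sectionFrame_forall_dim {P : Scheme.{0}} (q : P ⟶ Spec (.of O)) [IsSeparated q] (s : Spec (.of O) ⟶ P)
    (hs : s ≫ q = 𝟙 _) (hreg : IsRegularLocalRing (P.presheaf.stalk (s (IsLocalRing.closedPoint O))))
    (ϖ : O) (hϖ : Irreducible ϖ) :
    ∃ (n : ℕ) (c : Fin n → P.presheaf.stalk (s (IsLocalRing.closedPoint O)))
      (θ : (P.presheaf.stalk (s (IsLocalRing.closedPoint O)) ⧸ Ideal.span (Set.range c)) ≃+* O),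
      Ideal.span (Set.range c) = stalkIdeal s.ker (s (IsLocalRing.closedPoint O)) ∧ IsQuasiRegular c ∧
      IsDomain (P.presheaf.stalk (s (IsLocalRing.closedPoint O)) ⧸ Ideal.span (Set.range c)) ∧
      (∀ b : O, θ (Ideal.Quotient.mk _ ((P.presheaf.Γgerm (s (IsLocalRing.closedPoint O))).hom
        (q.appTop.hom ((Scheme.ΓSpecIso (.of O)).inv.hom b)))) = b) ∧
      Ideal.span (Set.range c) ⊔ Ideal.span {(P.presheaf.Γgerm (s (IsLocalRing.closedPoint O))).hom
        (q.appTop.hom ((Scheme.ΓSpecIso (.of O)).inv.hom ϖ))} =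
        maximalIdeal (P.presheaf.stalk (s (IsLocalRing.closedPoint O))) ∧
      (P.presheaf.Γgerm (s (IsLocalRing.closedPoint O))).hom (q.appTop.hom ((Scheme.ΓSpecIso (.of O)).inv.hom ϖ)) ∉
        Ideal.span (Set.range c) ∧
      ringKrullDim (P.presheaf.stalk (s (IsLocalRing.closedPoint O))) = (n + 1 : ℕ) := by
  classical
  haveI : IsClosedImmersion s := (section_isClosedImmersion_and_isRegular_ker O P q s hs).1
  haveI := hreg
  obtain ⟨eO, heO⟩ := exists_ringEquiv_stalk_closedPoint O
  have hsurj : Function.Surjective (s.stalkMap (IsLocalRing.closedPoint O)).hom :=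
    s.stalkMap_surjective (IsLocalRing.closedPoint O)
  have hker : RingHom.ker (s.stalkMap (IsLocalRing.closedPoint O)).hom =
      stalkIdeal s.ker (s (IsLocalRing.closedPoint O)) :=
    (stalkIdeal_ker_eq_ker_stalkMap s (IsLocalRing.closedPoint O)).symm
  let θ₀ : (P.presheaf.stalk (s (IsLocalRing.closedPoint O)) ⧸ stalkIdeal s.ker (s (IsLocalRing.closedPoint O))) ≃+* O :=
    ((Ideal.quotEquivOfEq hker.symm).trans (RingHom.quotientKerEquivOfSurjective hsurj)).trans eO.symm
  haveI : IsRegularLocalRing (P.presheaf.stalk (s (IsLocalRing.closedPoint O)) ⧸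
      stalkIdeal s.ker (s (IsLocalRing.closedPoint O))) := IsRegularLocalRing.of_ringEquiv θ₀.symm
  have hI𝔪 : stalkIdeal s.ker (s (IsLocalRing.closedPoint O)) ≤
      maximalIdeal (P.presheaf.stalk (s (IsLocalRing.closedPoint O))) := by
    rw [← hker]
    exact RingHom.ker_ne_top _ |> fun h => IsLocalRing.le_maximalIdeal h
  obtain ⟨u, hu, S, hS⟩ := exists_rsop_of_isRegularLocalRing_quotient hI𝔪
  let T : Finset (Fin (maximalIdeal (P.presheaf.stalk (s (IsLocalRing.closedPoint O)))).spanFinrank) := S.toFinset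
  let emb : Fin T.card → Fin (maximalIdeal (P.presheaf.stalk (s (IsLocalRing.closedPoint O)))).spanFinrank :=
    fun i => (T.equivFin.symm i).1
  have hemb : Function.Injective emb := fun i j h => T.equivFin.symm.injective (Subtype.ext h)
  have hrange : Set.range emb = S := by
    ext k
    constructor
    · rintro ⟨i, rfl⟩
      exact Set.mem_toFinset.mp (T.equivFin.symm i).2
    · intro hk
      exact ⟨T.equivFin ⟨k, Set.mem_toFinset.mpr hk⟩, by simp [emb]⟩
  have hcI : Ideal.span (Set.range (u ∘ emb)) = stalkIdeal s.ker (s (IsLocalRing.closedPoint O)) := by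
    rw [Set.range_comp, hrange, ← hS]
  have hrsop : IsRsopPart (u ∘ emb) := isRsopPart_comp_of_rsop rfl u hu emb hemb
  -- dimension: `dim R/(c) + n = dim R` and `R/(c) ≅ O` has dimension one
  have hdim : ringKrullDim (P.presheaf.stalk (s (IsLocalRing.closedPoint O))) = (T.card + 1 : ℕ) := by
    rw [← hrsop.ringKrullDim_quotient_add,
      ringKrullDim_eq_of_ringEquiv ((Ideal.quotEquivOfEq hcI).trans θ₀),
      IsDiscreteValuationRing.ringKrullDim_eq_one O]
    norm_cast
    exact add_comm 1 T.card
  obtain ⟨θ, hqr, hdom, hθ, h𝔪, hϖc⟩ :=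
    exists_sectionFrame_of_span_eq_forall O q s hs hreg ϖ hϖ (u ∘ emb) hcI hdim
  exact ⟨T.card, u ∘ emb, θ, hcI, hqr, hdom, hθ, h𝔪, hϖc, hdim⟩

/-- The frame with dimension at a NAMED point `p` with `s(s₀) = p` (all data at `p`; `p := j x`, the special point of the
model square, in HΔ(AdmTC)). [cite: Matsumura1987, Thm. 14.2] -/
theorem exists_sectionFrame_forall_dim_at {P : Scheme.{0}} (q : P ⟶ Spec (.of O)) [IsSeparated q] (s : Spec (.of O) ⟶ P)
    (hs : s ≫ q = 𝟙 _) (p : P) (hp : s (IsLocalRing.closedPoint O) = p) (hreg : IsRegularLocalRing (P.presheaf.stalk p))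
    (ϖ : O) (hϖ : Irreducible ϖ) :
    ∃ (n : ℕ) (c : Fin n → P.presheaf.stalk p) (θ : (P.presheaf.stalk p ⧸ Ideal.span (Set.range c)) ≃+* O),
      Ideal.span (Set.range c) = stalkIdeal s.ker p ∧ IsQuasiRegular c ∧
      IsDomain (P.presheaf.stalk p ⧸ Ideal.span (Set.range c)) ∧
      (∀ b : O, θ (Ideal.Quotient.mk _ ((P.presheaf.Γgerm p).hom (q.appTop.hom ((Scheme.ΓSpecIso (.of O)).inv.hom b)))) = b) ∧
      Ideal.span (Set.range c) ⊔ Ideal.span {(P.presheaf.Γgerm p).hom (q.appTop.hom ((Scheme.ΓSpecIso (.of O)).inv.hom ϖ))} =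
        maximalIdeal (P.presheaf.stalk p) ∧
      (P.presheaf.Γgerm p).hom (q.appTop.hom ((Scheme.ΓSpecIso (.of O)).inv.hom ϖ)) ∉ Ideal.span (Set.range c) ∧
      ringKrullDim (P.presheaf.stalk p) = (n + 1 : ℕ) := by
  subst hp
  exact exists_sectionFrame_forall_dim O q s hs hreg ϖ hϖ

end Summit.ResolutionOfSingularities.ResolutionOfSingularities.Cruxes.EquisingularLiftNat.Sections

end
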